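import Summits.AtomisticToContinuum.FouriersLaw.Theses.EmbeddedDrudeMourre

/-!
# Disproof of `MourreDissolution` — standing adversary file (cdisprove, stmt-AtomisticToContinuum-12594)

Crux (route `EmbeddedDrudeMourre`, sub-problem `FouriersLaw`):
`MourreDissolution = ∀ ω₂ lam β γ > 0, HasOddSectorGap ω₂ lam β → ∃ T₀ > 0, ∀ T ∈ (0,T₀), DissolvedAt ω₂ lam β γ T`
where `DissolvedAt` (below, `Iff.rfl` with the route text) is the body of the target
`DrudeDissolution`: a Gibbs state `μ_T`, a `μ_T`-preserving `InfiniteChainDynamics`, absolutely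
convergent current correlations, `C_T(t) = ∫ cos(ωt) dσ(ω)` for a finite `σ` with a continuous
density `g ≥ 0`, `g(0) > 0`, on a window `(-δ, δ)`.

## Findings (index; details in the docstrings)

* §1 `DissolvedAt`, `mourreDissolution_iff` — the crux restated (`Iff.rfl`).
* §2 LOAD-BEARING ANALYSIS of the scalar hypotheses.
  - `0 < γ` is NOT load-bearing: the bath constant `γ` is invisible to `U`, `V`, the DLR
    specification, the dynamics structure and the current (`dissolvedAt_gamma_iff`, all by `rfl`
    transport), hence `mourreDissolution_iff_withoutGammaPos : MourreDissolution ↔ (same, no 0<γ)`.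
  - `0 < lam`, `0 < β` are subsumed by the gap hypothesis at the harmonic corner:
    `not_hasOddSectorGap_zero_zero : ¬ HasOddSectorGap ω₂ 0 0` (the form vanishes identically when
    both quartic vertices vanish), so at `lam = β = 0` the crux is VACUOUSLY true although its
    conclusion is (informally: harmonic Drude atom, Mazur) false there — see §5.
  - the gap hypothesis is blind to the SIGN and SIZE of the couplings:
    `hasOddSectorGap_smul_iff : ε ≠ 0 → (HasOddSectorGap ω₂ (ε*a) (ε*b) ↔ HasOddSectorGap ω₂ a b)`;
    it is a property of `(ω₂, [a : b])` only, so ALL `lam`-dependence of the conclusion must be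
    carried by `T₀` (expected `T₀ ≍ ε₀(ω₂, β/lam)/lam`).
* §3 ANATOMY OF THE GAP HYPOTHESIS (which of ITS clauses are load-bearing — information for FGRGap
  and for the size of the Mourre constant):
  - drop `Function.Odd f` ⇒ false for every `(ω₂,a,b)` (`not_hasGapWithoutOdd`, witness `f = 1`,
    phonon number);
  - drop `Function.Periodic f (2π)` ⇒ false for every `(ω₂,a,b)` (`not_hasGapWithoutPeriodic`,
    witness `f = id`: MOMENTUM `ψ(k) = k` is an odd collisional invariant of the non-umklapp
    kinematics, `isCollisionalInvariant_id`). Hence any odd-sector gap — and with it the route's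
    Mourre constant `cλ²` — is produced ENTIRELY by umklapp (the `2π`-reduction of `k₄`); a proof of
    FGRGap must use periodicity essentially, and `g₀(ω₂,a,b) → 0` in any regime where umklapp weight
    vanishes.
* §3b VACUITY MAP ACROSS THE VERTEX FAMILY (PROVED; the finiteness of the non-degenerate resonant
  fibres `resonantSetsFinite : 0 < ω₂ → ResonantSetsFinite ω₂` — isolated zeros of the analytic
  resonance function plus an explicit non-vanishing witness — is proved here and is also the first
  input of any coercivity proof of FGRGap):
  `boltzmannForm_le_of_vertex_sq_le` (vertex domination ⇒ form domination),
  `hasOddSectorGap_onSite_of : HasOddSectorGap ω₂ a b → HasOddSectorGap ω₂ 1 0` (ANY gap in the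
  family forces ALS's pure on-site gap; so if ALS's `L` has an odd null vector at some `ω₂` the
  crux is vacuous there for EVERY `(lam, β)` — `not_hasOddSectorGap_of_not_onSite`), and
  `hasOddSectorGap_of_onSite` (for `16|β| < |lam|` the converse: on that ray the hypothesis IS
  ALS's gap). Heuristic complement (numerics §4, not formal): at `lam = 0 < β` the FPU vertex
  `16β∏sin(k_j/2)` switches off every collision of a `k → 0` phonon, odd bumps at `k ≈ 0` have
  Rayleigh quotient `≲ ε² log(1/ε) → 0`, so `HasOddSectorGap ω₂ 0 β` should FAIL although the
  kinetic conductivity stays finite (`K(τ) ∼ τ^{-3/2}`): the gap hypothesis is sufficient, not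
  necessary, for a dissolved atom — and `g₀(lam, β) ≍ lam² log(β/lam)` as `lam/β → 0`, so the
  Mourre constant and `T₀` must degrade on FPU-dominated rays.
* §4 NUMERICAL EVIDENCE (kit compute jobs, ids in the docstrings): Galerkin bottom of the odd
  sector of `q` (hypothesis satisfiable? — non-vacuity of the crux) and equilibrium MD periodogram
  of the total current of `pinnedChain 1 1 1` at `T ∈ [0.1, 1]` (conclusion plausible? — plateau vs
  atom/cusp at `ω = 0`).
* §5 THE ONLY UNIFORM KILL OF THE CONCLUSION — A DRUDE WEIGHT (PROVED bridge, kill criterion (a)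
  of the route made formal): `tendsto_cesaro_cosTransform_zero` — a finite measure with ANY density
  on a window around `0` has cosine transform of vanishing Cesàro mean (`τ⁻¹∫₀^τ C → σ{0} = 0`,
  Fubini + dominated convergence, no continuity of `g` used); hence every witness of `DissolvedAt`
  has zero Drude weight (`cesaro_currentCorrelation_zero_of_window`) and
  `not_dissolvedAt_of_drudeWeight`: if EVERY admissible `(μ_T, D)` has a current autocorrelation
  whose Cesàro mean does not tend to `0` (Mazur: an odd conserved charge of the EQUATIONS OF MOTION
  overlapping `J`, `Literature.Barriers.AtomisticToContinuum.Mazur1969_inequality`), the conclusion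
  fails at that point; `not_mourreDissolution_of_drudeWeight` is the resulting refutation schema for
  the crux (needs, in addition, a PROVED gap point — kill criterion (c)). No such charge is known or
  expected for `lam, β > 0` (pinned, non-integrable); this is WHY the crux resists: short of a new
  conservation law, `¬ DissolvedAt` must classify all `μ`-preserving dynamics.
* §6 NEAR-MISS (sorried, with the obstruction): the harmonic Drude atom `¬ DissolvedAt ω₂ 0 0 γ T`
  — even with §5 it needs the classification of ALL `μ`-preserving `InfiniteChainDynamics` of the
  harmonic chain (uniqueness of tempered solutions of the infinite lattice ODE inside a `μ`-full
  carrier) and of its DLR states, to know that `J`'s conserved part is seen by every witness.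

All theorems outside §6 are sorry-free (lean check rc 0); §6 contains the only `sorry`.
-/

noncomputable section

namespace Summit.AtomisticToContinuum.FouriersLaw.Cruxes.MourreDissolution.Disproof

open MeasureTheory Set Real
open scoped ENNReal
open Literature.MathematicalPhysics.KineticTheory.PhononBoltzmann
open Literature.MathematicalPhysics.KineticTheory.HeatConduction
open Summit.AtomisticToContinuum.FouriersLaw.Theses.EmbeddedDrudeMourre (MourreDissolution DrudeDissolution FGRGap)

/-! ## §1 The crux restated -/

/-- The conclusion body of the crux / of the target `DrudeDissolution` at one parameter point and
one temperature: the DISSOLVED DRUDE ATOM at `(ω₂, lam, β, γ; T)`. -/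
def DissolvedAt (ω₂ lam β γ T : ℝ) : Prop :=
  ∃ (μT : Measure ChainConfig) (D : InfiniteChainDynamics (pinnedChain ω₂ lam β γ)),
    (pinnedChain ω₂ lam β γ).IsChainGibbsMeasure T μT ∧ D.PreservesMeasure μT ∧
    (∀ t : ℝ, D.HasAbsConvergentCorrelation μT t) ∧
    ∃ σ : Measure ℝ, IsFiniteMeasure σ ∧
      (∀ t : ℝ, D.currentCorrelation μT t = ∫ ω, Real.cos (ω * t) ∂σ) ∧
      ∃ (δ : ℝ) (g : ℝ → ℝ), 0 < δ ∧ ContinuousOn g (Ioo (-δ) δ) ∧ (∀ ω ∈ Ioo (-δ) δ, 0 ≤ g ω) ∧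
        0 < g 0 ∧ σ.restrict (Ioo (-δ) δ) =
          (volume.restrict (Ioo (-δ) δ)).withDensity (fun ω => ENNReal.ofReal (g ω))

/-- The crux, literally: `MourreDissolution` is the gap-conditional dissolution below a threshold
temperature. -/
theorem mourreDissolution_iff :
    MourreDissolution ↔
      ∀ ω₂ lam β γ : ℝ, 0 < ω₂ → 0 < lam → 0 < β → 0 < γ → HasOddSectorGap ω₂ lam β →
        ∃ T₀ : ℝ, 0 < T₀ ∧ ∀ T : ℝ, 0 < T → T < T₀ → DissolvedAt ω₂ lam β γ T :=
  Iff.rfl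

/-- The target, literally. -/
theorem drudeDissolution_iff :
    DrudeDissolution ↔
      ∀ ω₂ lam β γ : ℝ, 0 < ω₂ → 0 < lam → 0 < β → 0 < γ →
        ∃ T₀ : ℝ, 0 < T₀ ∧ ∀ T : ℝ, 0 < T → T < T₀ → DissolvedAt ω₂ lam β γ T :=
  Iff.rfl

/-! ## §2 Load-bearing analysis of the scalar hypotheses -/

/-- Transport of an infinite-volume dynamics across the bath constant: `pinnedChain ω₂ lam β γ` and
`pinnedChain ω₂ lam β γ'` have the same `U` and `V` (by `rfl`), hence the same equations of motion;
the structure is re-indexed field by field. -/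
def regamma {ω₂ lam β γ : ℝ} (γ' : ℝ) (D : InfiniteChainDynamics (pinnedChain ω₂ lam β γ)) :
    InfiniteChainDynamics (pinnedChain ω₂ lam β γ') where
  carrier := D.carrier
  flow := D.flow
  mapsTo := D.mapsTo
  flow_zero := D.flow_zero
  isSolution := D.isSolution
  unique := D.unique

/-- `γ` is invisible to the conclusion: the dissolved-atom property does not depend on the bath
constant (the chain data `U, V`, the DLR specification, the current and the dynamics are `rfl`-equal
across `γ`). -/
theorem dissolvedAt_gamma_iff (ω₂ lam β γ γ' T : ℝ) :
    DissolvedAt ω₂ lam β γ T ↔ DissolvedAt ω₂ lam β γ' T := by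
  constructor
  · rintro ⟨μT, D, hG, hP, hA, rest⟩
    exact ⟨μT, regamma γ' D, hG, hP, hA, rest⟩
  · rintro ⟨μT, D, hG, hP, hA, rest⟩
    exact ⟨μT, regamma γ D, hG, hP, hA, rest⟩

/-- The crux with the hypothesis `0 < γ` DROPPED. -/
def MourreDissolutionWithoutGammaPos : Prop :=
  ∀ ω₂ lam β γ : ℝ, 0 < ω₂ → 0 < lam → 0 < β → HasOddSectorGap ω₂ lam β →
    ∃ T₀ : ℝ, 0 < T₀ ∧ ∀ T : ℝ, 0 < T → T < T₀ → DissolvedAt ω₂ lam β γ T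

/-- **`0 < γ` is not load-bearing**: the crux is EQUIVALENT to its `γ`-unrestricted form (so no
"false without `0 < γ`" theorem exists; provers may fix `γ = 1`). -/
theorem mourreDissolution_iff_withoutGammaPos :
    MourreDissolution ↔ MourreDissolutionWithoutGammaPos := by
  rw [mourreDissolution_iff]
  constructor
  · intro h ω₂ lam β γ hω hl hβ hgap
    obtain ⟨T₀, hT₀, hT⟩ := h ω₂ lam β 1 hω hl hβ one_pos hgap
    exact ⟨T₀, hT₀, fun T h1 h2 => (dissolvedAt_gamma_iff ω₂ lam β 1 γ T).1 (hT T h1 h2)⟩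
  · intro h ω₂ lam β γ hω hl hβ _ hgap
    exact h ω₂ lam β γ hω hl hβ hgap

/-- The crux at the single bath constant `γ = 1` already implies the crux. -/
theorem mourreDissolution_iff_gamma_one :
    MourreDissolution ↔
      ∀ ω₂ lam β : ℝ, 0 < ω₂ → 0 < lam → 0 < β → HasOddSectorGap ω₂ lam β →
        ∃ T₀ : ℝ, 0 < T₀ ∧ ∀ T : ℝ, 0 < T → T < T₀ → DissolvedAt ω₂ lam β 1 T := by
  rw [mourreDissolution_iff_withoutGammaPos]
  constructor
  · intro h ω₂ lam β hω hl hβ hgap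
    exact h ω₂ lam β 1 hω hl hβ hgap
  · intro h ω₂ lam β γ hω hl hβ hgap
    obtain ⟨T₀, hT₀, hT⟩ := h ω₂ lam β hω hl hβ hgap
    exact ⟨T₀, hT₀, fun T h1 h2 => (dissolvedAt_gamma_iff ω₂ lam β 1 γ T).1 (hT T h1 h2)⟩

/-- **Coupling-scale and SIGN blindness of the gap hypothesis**: `q_{εa,εb} = ε² q_{a,b}`
(`boltzmannForm_smul`), so for every `ε ≠ 0` (negative `ε` included — the kinetic form does not see
the sign of the quartic couplings) `HasOddSectorGap ω₂ (εa) (εb) ↔ HasOddSectorGap ω₂ a b`. The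
hypothesis is a property of `(ω₂, [a : b])`; cf. the temperature form `ε = T > 0` attached by the
crux-attack refuter (`hasOddSectorGap_iff_temperature`). -/
theorem hasOddSectorGap_smul_iff (ω₂ a b : ℝ) {ε : ℝ} (hε : ε ≠ 0) :
    HasOddSectorGap ω₂ (ε * a) (ε * b) ↔ HasOddSectorGap ω₂ a b := by
  have key : ∀ (a b ε : ℝ), ε ≠ 0 → HasOddSectorGap ω₂ a b → HasOddSectorGap ω₂ (ε * a) (ε * b) := by
    intro a b ε hε ⟨g, hg, h⟩
    refine ⟨ε ^ 2 * g, mul_pos (pow_pos (abs_pos.mpr hε) 2 |>.trans_eq (sq_abs ε)) hg, ?_⟩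
    intro f hp hm ho hn
    rw [boltzmannForm_smul, ENNReal.ofReal_mul (sq_nonneg ε), mul_assoc]
    gcongr
    exact h f hp hm ho hn
  constructor
  · intro h
    have h' := key (ε * a) (ε * b) ε⁻¹ (inv_ne_zero hε) h
    rwa [← mul_assoc, ← mul_assoc, inv_mul_cancel₀ hε, one_mul, one_mul] at h'
  · exact key a b ε hε

/-- Sign blindness, spelled out: `(lam, β) ↦ (-lam, -β)` (an unstable chain) has the same kinetic
hypothesis. -/
theorem hasOddSectorGap_neg_iff (ω₂ a b : ℝ) :
    HasOddSectorGap ω₂ (-a) (-b) ↔ HasOddSectorGap ω₂ a b := by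
  have h := hasOddSectorGap_smul_iff ω₂ a b (ε := -1) (by norm_num)
  simpa using h

/-- At the HARMONIC corner both quartic vertices vanish and so does the whole form:
`q_{0,0} ≡ 0`. -/
theorem boltzmannForm_zero_zero (ω₂ : ℝ) (f : ℝ → ℝ) : boltzmannForm ω₂ 0 0 f = 0 := by
  have h := boltzmannForm_smul ω₂ 1 1 0 f
  simpa using h

/-- `‖sin‖² > 0` on the Brillouin cell (used by every witness below). -/
theorem cellNormSq_sin_pos : 0 < cellNormSq Real.sin := by
  unfold cellNormSq
  have hmeas : Measurable fun k : ℝ => ENNReal.ofReal (Real.sin k ^ 2) :=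
    (Real.measurable_sin.pow_const 2).ennreal_ofReal
  rw [lintegral_pos_iff_support hmeas]
  have hsub : Ioo 0 π ⊆ Function.support (fun k : ℝ => ENNReal.ofReal (Real.sin k ^ 2)) ∩ Ioc (-π) π := by
    intro k hk
    refine ⟨?_, ⟨by linarith [hk.1, Real.pi_pos], hk.2.le⟩⟩
    have hs : 0 < Real.sin k := Real.sin_pos_of_pos_of_lt_pi hk.1 hk.2
    simp only [Function.mem_support, ne_eq, ENNReal.ofReal_eq_zero, not_le]
    positivity
  calc (0 : ℝ≥0∞) < volume (Ioo (0 : ℝ) π) := by simp [Real.volume_Ioo, Real.pi_pos]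
    _ ≤ volume (Function.support (fun k : ℝ => ENNReal.ofReal (Real.sin k ^ 2)) ∩ Ioc (-π) π) :=
        measure_mono hsub
    _ = (volume.restrict (Ioc (-π) π)) (Function.support fun k : ℝ => ENNReal.ofReal (Real.sin k ^ 2)) := by
        rw [Measure.restrict_apply' measurableSet_Ioc]

/-- `‖sin‖² < ∞` on the cell. -/
theorem cellNormSq_sin_lt_top : cellNormSq Real.sin < ∞ := by
  unfold cellNormSq
  refine (setLIntegral_lt_top_of_le_nnreal ?_ ⟨1, fun k _ => ?_⟩)
  · simp [Real.volume_Ioc]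
  · rw [ENNReal.ofReal_le_iff_le_toReal ENNReal.coe_ne_top]
    simp only [ENNReal.coe_one, ENNReal.toReal_one]
    nlinarith [Real.sin_sq_le_one k]

/-- **The gap hypothesis FAILS at the harmonic corner** `lam = β = 0` (witness `f = sin`, odd,
periodic, `q_{0,0}(sin) = 0 < g‖sin‖²`): there the crux is vacuously true — the hypothesis is what
removes the one parameter point where the conclusion is known (informally, Mazur/RLL) to fail.
Any proof of the crux that did not use `HasOddSectorGap` would prove `DrudeDissolution` outright. -/
theorem not_hasOddSectorGap_zero_zero (ω₂ : ℝ) : ¬ HasOddSectorGap ω₂ 0 0 := by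
  rintro ⟨g, hg, h⟩
  have h1 := h Real.sin (fun k => Real.sin_add_two_pi k) Real.measurable_sin
    (fun k => Real.sin_neg k) cellNormSq_sin_lt_top
  rw [boltzmannForm_zero_zero, nonpos_iff_eq_zero, mul_eq_zero] at h1
  rcases h1 with h1 | h1
  · exact (ENNReal.ofReal_pos.mpr hg).ne' h1
  · exact cellNormSq_sin_pos.ne' h1

/-- Consequently a gap forces SOME anharmonicity: `HasOddSectorGap ω₂ a b → a ≠ 0 ∨ b ≠ 0`. -/
theorem anharmonic_of_hasOddSectorGap {ω₂ a b : ℝ} (h : HasOddSectorGap ω₂ a b) : a ≠ 0 ∨ b ≠ 0 := by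
  by_contra hab
  simp only [not_or, not_not] at hab
  obtain ⟨rfl, rfl⟩ := hab
  exact not_hasOddSectorGap_zero_zero ω₂ h

/-! ## §3 Anatomy of the gap hypothesis: its own load-bearing clauses -/

/-- The gap property with the PARITY restriction dropped. -/
def HasGapWithoutOdd (ω₂ a b : ℝ) : Prop :=
  ∃ g : ℝ, 0 < g ∧ ∀ f : ℝ → ℝ, Function.Periodic f (2 * π) → Measurable f →
    cellNormSq f < ∞ → ENNReal.ofReal g * cellNormSq f ≤ boltzmannForm ω₂ a b f

/-- `‖1‖² = 2π ∈ (0, ∞)` on the cell. -/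
theorem cellNormSq_one : cellNormSq (fun _ => (1 : ℝ)) = ENNReal.ofReal (2 * π) := by
  unfold cellNormSq
  simp only [one_pow, ENNReal.ofReal_one, lintegral_const, Measure.restrict_apply, univ_inter,
    MeasurableSet.univ, Real.volume_Ioc, one_mul]
  congr 1; ring

/-- **Parity is load-bearing** in the hypothesis: without `Function.Odd f` the gap property is
false for EVERY `(ω₂, a, b)` — phonon number `f = 1` is an (even) null vector
(`boltzmannForm_const_add_mul_dispersion`). -/
theorem not_hasGapWithoutOdd (ω₂ a b : ℝ) : ¬ HasGapWithoutOdd ω₂ a b := by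
  rintro ⟨g, hg, h⟩
  have h1 := h (fun _ => (1 : ℝ)) (fun _ => rfl) measurable_const
    (by rw [cellNormSq_one]; exact ENNReal.ofReal_lt_top)
  have hq : boltzmannForm ω₂ a b (fun _ => (1 : ℝ)) = 0 := by
    have := boltzmannForm_const_add_mul_dispersion ω₂ a b 1 0
    simpa using this
  rw [hq, nonpos_iff_eq_zero, mul_eq_zero, cellNormSq_one] at h1
  rcases h1 with h1 | h1
  · exact (ENNReal.ofReal_pos.mpr hg).ne' h1
  · exact (ENNReal.ofReal_pos.mpr (by positivity : (0:ℝ) < 2 * π)).ne' h1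

/-- The gap property with PERIODICITY dropped (test functions on `ℝ`, not on `𝕋`). -/
def HasGapWithoutPeriodic (ω₂ a b : ℝ) : Prop :=
  ∃ g : ℝ, 0 < g ∧ ∀ f : ℝ → ℝ, Measurable f → Function.Odd f →
    cellNormSq f < ∞ → ENNReal.ofReal g * cellNormSq f ≤ boltzmannForm ω₂ a b f

/-- **Momentum is an odd collisional invariant of the non-umklapp kinematics**: `ψ(k) = k`
satisfies `ψ₁ + ψ₂ = ψ₃ + ψ₄` on the momentum shell `k₄ = k₁ + k₂ - k₃` identically (whatever the
energy constraint). It is excluded from `IsCollisionalInvariant`-based statements ONLY by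
periodicity (`k₄` is not reduced mod `2π` in the tree's resonant set). -/
theorem isCollisionalInvariant_id (ω₂ : ℝ) : IsCollisionalInvariant ω₂ (fun k => k) := by
  intro k₁ k₂ k₃ _
  ring

/-- `‖id‖² ∈ (0, ∞)` on the cell: lower bound through `sin² ≤ k²`. -/
theorem cellNormSq_id_pos : 0 < cellNormSq (fun k => k) := by
  refine cellNormSq_sin_pos.trans_le ?_
  unfold cellNormSq
  refine lintegral_mono fun k => ENNReal.ofReal_le_ofReal ?_
  have h1 := Real.abs_sin_le_abs (x := k)
  calc Real.sin k ^ 2 = |Real.sin k| ^ 2 := (sq_abs _).symm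
    _ ≤ |k| ^ 2 := pow_le_pow_left₀ (abs_nonneg _) h1 2
    _ = k ^ 2 := sq_abs k

theorem cellNormSq_id_lt_top : cellNormSq (fun k => k) < ∞ := by
  unfold cellNormSq
  refine setLIntegral_lt_top_of_le_nnreal ?_ ⟨(π ^ 2).toNNReal, fun k hk => ?_⟩
  · simp [Real.volume_Ioc]
  · show ENNReal.ofReal (k ^ 2) ≤ ENNReal.ofReal (π ^ 2)
    apply ENNReal.ofReal_le_ofReal
    have h1 : -π < k := hk.1
    have h2 : k ≤ π := hk.2
    nlinarith

/-- **Periodicity (umklapp) is load-bearing** in the hypothesis: without `Function.Periodic f (2π)`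
the gap property is false for EVERY `(ω₂, a, b)` — witness the momentum `f = id`, odd, square
integrable on the cell, with `q(id) = 0` (`isCollisionalInvariant_id`). So whatever odd-sector gap
the pinned band has is created entirely by umklapp; the route's Mourre constant `cλ²` inherits this. -/
theorem not_hasGapWithoutPeriodic (ω₂ a b : ℝ) : ¬ HasGapWithoutPeriodic ω₂ a b := by
  rintro ⟨g, hg, h⟩
  have h1 := h (fun k => k) measurable_id (fun k => rfl) cellNormSq_id_lt_top
  rw [boltzmannForm_eq_zero_of_isCollisionalInvariant a b (isCollisionalInvariant_id ω₂),
    nonpos_iff_eq_zero, mul_eq_zero] at h1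
  rcases h1 with h1 | h1
  · exact (ENNReal.ofReal_pos.mpr hg).ne' h1
  · exact cellNormSq_id_pos.ne' h1

/-! ## §3b The two-vertex family against ALS's on-site gap (vacuity map; conditional on finite resonant sets) -/

/-- Finiteness of the non-degenerate resonant sets on the cell: for `k₁ ≠ k₃` in `(-π, π]` the
zeros `k₂ ∈ (-π, π]` of `Ω(k₁, ·, k₃)` are finitely many. Kept as a named predicate (the
comparison lemmas below take it as a hypothesis) and PROVED for every `ω₂ > 0` right after
(`resonantSetsFinite`: isolated zeros of a real-analytic function + an explicit non-vanishing
witness). -/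
def ResonantSetsFinite (ω₂ : ℝ) : Prop :=
  ∀ k₁ ∈ Ioc (-π) π, ∀ k₃ ∈ Ioc (-π) π, k₁ ≠ k₃ → (resonantSet ω₂ k₁ k₃).Finite

section Finiteness
open Filter Topology

/-- The real square root is real-analytic on `(0, ∞)` (`√t = exp(log t / 2)`; same proof as
`Literature.Analysis.FluidPDE.analyticAt_sqrt`, repeated to keep the import cone small). -/
theorem analyticAt_sqrt {t : ℝ} (ht : 0 < t) : AnalyticAt ℝ Real.sqrt t := by
  have h : AnalyticAt ℝ (fun τ : ℝ => Real.exp (Real.log τ / 2)) t := by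
    fun_prop (disch := assumption)
  refine h.congr ?_
  filter_upwards [Ioi_mem_nhds ht] with τ hτ
  rw [Real.sqrt_eq_rpow, Real.rpow_def_of_pos hτ]
  congr 1; ring

/-- The pinned band is real-analytic (`ω₂ > 0`: the radicand stays `≥ ω₂ > 0`). -/
theorem analyticAt_dispersion {ω₂ : ℝ} (hω : 0 < ω₂) (k : ℝ) : AnalyticAt ℝ (dispersion ω₂) k := by
  have hpos : 0 < ω₂ + 2 * (1 - Real.cos k) := by
    have := two_mul_one_sub_cos_nonneg k
    linarith
  have h1 : AnalyticAt ℝ (fun k : ℝ => ω₂ + 2 * (1 - Real.cos k)) k := by fun_prop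
  exact (analyticAt_sqrt hpos).comp_of_eq h1 rfl

/-- The resonance function is real-analytic in the partner momentum `k₂`. -/
theorem analyticAt_resonanceFn {ω₂ : ℝ} (hω : 0 < ω₂) (k₁ k₃ k₂ : ℝ) :
    AnalyticAt ℝ (fun q => resonanceFn ω₂ k₁ q k₃) k₂ := by
  unfold resonanceFn
  have h2 := analyticAt_dispersion hω k₂
  have h4 : AnalyticAt ℝ (fun q : ℝ => dispersion ω₂ (k₁ + q - k₃)) k₂ := by
    have hlin : AnalyticAt ℝ (fun q : ℝ => k₁ + q - k₃) k₂ := by fun_prop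
    exact (analyticAt_dispersion hω (k₁ + k₂ - k₃)).comp_of_eq hlin rfl
  exact ((analyticAt_const.add h2).sub analyticAt_const).sub h4

/-- Zeros of an everywhere-analytic, not identically vanishing real function are finite on
compacts (isolated zeros + a finite subcover). -/
theorem finite_zeros_of_analyticAt {f : ℝ → ℝ} (hf : ∀ x, AnalyticAt ℝ f x) {x₀ : ℝ}
    (hx₀ : f x₀ ≠ 0) {K : Set ℝ} (hK : IsCompact K) : {x | x ∈ K ∧ f x = 0}.Finite := by
  have hU : ∀ z : ℝ, {w : ℝ | w ≠ z → f w ≠ 0} ∈ 𝓝 z := by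
    intro z
    rcases (hf z).eventually_eq_zero_or_eventually_ne_zero with h | h
    · exfalso
      have hall := AnalyticOnNhd.eqOn_zero_of_preconnected_of_eventuallyEq_zero
        (f := f) (U := univ) (fun x _ => hf x) isPreconnected_univ (mem_univ z) h
      exact hx₀ (hall (mem_univ x₀))
    · exact eventually_nhdsWithin_iff.1 h
  obtain ⟨t, -, hcover⟩ := hK.elim_nhds_subcover (fun z => {w : ℝ | w ≠ z → f w ≠ 0}) (fun z _ => hU z)
  refine t.finite_toSet.subset ?_
  rintro x ⟨hxK, hfx⟩
  have hx := hcover hxK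
  simp only [mem_iUnion] at hx
  obtain ⟨z, hzt, hz⟩ := hx
  have hxz : x = z := by
    by_contra hne
    exact hz hne hfx
  rw [hxz]
  exact hzt

/-- On the cell, `k₁ ≠ k₃` forces `cos(k₁ - k₃) < 1`. -/
theorem cos_sub_lt_one {k₁ k₃ : ℝ} (hk₁ : k₁ ∈ Ioc (-π) π) (hk₃ : k₃ ∈ Ioc (-π) π) (hne : k₁ ≠ k₃) :
    Real.cos (k₁ - k₃) < 1 := by
  refine lt_of_le_of_ne (Real.cos_le_one _) fun h => ?_
  obtain ⟨n, hn⟩ := (Real.cos_eq_one_iff _).1 h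
  have h1 : -π < k₁ := hk₁.1
  have h2 : k₁ ≤ π := hk₁.2
  have h3 : -π < k₃ := hk₃.1
  have h4 : k₃ ≤ π := hk₃.2
  have hlt : |(n : ℝ) * (2 * π)| < 2 * π := by
    rw [hn, abs_lt]
    constructor <;> linarith
  have hn0 : n = 0 := by
    by_contra hn0
    have h1n : (1 : ℝ) ≤ |(n : ℝ)| := by
      rw [← Int.cast_abs]
      exact_mod_cast Int.one_le_abs hn0
    have : 2 * π ≤ |(n : ℝ) * (2 * π)| := by
      rw [abs_mul, abs_of_pos (by positivity : (0 : ℝ) < 2 * π)]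
      nlinarith [Real.pi_pos]
    linarith
  subst hn0
  simp at hn
  exact hne (by linarith)

/-- **The non-degenerate resonant fibres are finite** (`ω₂ > 0`): for `k₁ ≠ k₃` in `(-π, π]` the
set of partner momenta `k₂ ∈ (-π, π]` with `Ω(k₁, k₂, k₃) = 0` is finite. Witness of
non-vanishing: `Ω(k₁, -(k₁-k₃)/2, k₃) = ω(k₁) - ω(k₃)` and `Ω(k₁, 0, k₃) = ω(k₁) - ω(k₃) + √ω₂ -
ω(k₁ - k₃)` cannot both vanish since `ω(k₁ - k₃) > √ω₂`. This discharges the hypothesis of §3b and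
is the first input any coercivity proof of FGRGap needs (the resolved energy delta is a finite sum). -/
theorem resonantSetsFinite {ω₂ : ℝ} (hω : 0 < ω₂) : ResonantSetsFinite ω₂ := by
  intro k₁ hk₁ k₃ hk₃ hne
  set c := k₁ - k₃ with hc
  have hcos : Real.cos c < 1 := cos_sub_lt_one hk₁ hk₃ hne
  have hgap : dispersion ω₂ 0 < dispersion ω₂ c := by
    unfold dispersion
    rw [Real.cos_zero]
    apply Real.sqrt_lt_sqrt (by linarith)
    linarith
  have heven : dispersion ω₂ (-(c / 2)) = dispersion ω₂ (c - c / 2) := by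
    rw [dispersion_neg, show c - c / 2 = c / 2 by ring]
  obtain ⟨x₀, hx₀⟩ : ∃ x₀ : ℝ, resonanceFn ω₂ k₁ x₀ k₃ ≠ 0 := by
    by_cases h : resonanceFn ω₂ k₁ (-(c / 2)) k₃ = 0
    · refine ⟨0, ?_⟩
      have h' : dispersion ω₂ k₁ - dispersion ω₂ k₃ = 0 := by
        unfold resonanceFn at h
        rw [show k₁ + -(c / 2) - k₃ = c - c / 2 by rw [hc]; ring, ← heven] at h
        linarith
      unfold resonanceFn
      rw [add_zero, show k₁ - k₃ = c from rfl]
      intro h0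
      linarith
    · exact ⟨_, h⟩
  have hfin := finite_zeros_of_analyticAt (fun x => analyticAt_resonanceFn hω k₁ k₃ x) hx₀
    (isCompact_Icc (a := -π) (b := π))
  refine hfin.subset ?_
  intro k₂ hk₂
  exact ⟨Ioc_subset_Icc_self hk₂.1, hk₂.2⟩

end Finiteness

/-- Monotonicity of a finite `finsum` over a set. -/
theorem finsum_mem_mono_of_finite {s : Set ℝ} (hs : s.Finite) {u v : ℝ → ℝ}
    (h : ∀ k ∈ s, u k ≤ v k) : ∑ᶠ k ∈ s, u k ≤ ∑ᶠ k ∈ s, v k := by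
  rw [finsum_mem_def, finsum_mem_def]
  refine finsum_le_finsum' (hs.subset (support_indicator_subset)) (hs.subset (support_indicator_subset)) ?_
  intro k
  by_cases hk : k ∈ s
  · simp [indicator_of_mem hk, h k hk]
  · simp [indicator_of_notMem hk]

/-- **Vertex domination ⇒ form domination** (conditional on `ResonantSetsFinite`): if
`Φ'² ≤ c Φ²` pointwise then `q' ≤ c q`. -/
theorem boltzmannForm_le_of_vertex_sq_le {ω₂ : ℝ} (hfin : ResonantSetsFinite ω₂) {a b a' b' c : ℝ}
    (hc : 0 ≤ c) (h : ∀ k₁ k₂ k₃ : ℝ, vertex a' b' k₁ k₂ k₃ ^ 2 ≤ c * vertex a b k₁ k₂ k₃ ^ 2)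
    (f : ℝ → ℝ) : boltzmannForm ω₂ a' b' f ≤ ENNReal.ofReal c * boltzmannForm ω₂ a b f := by
  unfold boltzmannForm
  rw [mul_left_comm]
  gcongr ENNReal.ofReal (1 / 4) * ?_
  rw [← lintegral_const_mul' _ _ ENNReal.ofReal_ne_top]
  refine setLIntegral_mono' measurableSet_Ioc fun k₁ hk₁ => ?_
  rw [← lintegral_const_mul' _ _ ENNReal.ofReal_ne_top]
  refine setLIntegral_mono' measurableSet_Ioc fun k₃ hk₃ => ?_
  rw [← ENNReal.ofReal_mul hc, mul_finsum_mem]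
  apply ENNReal.ofReal_le_ofReal
  -- pointwise comparison of the resolved integrands
  have hpt : ∀ k₂ : ℝ, collisionWeight ω₂ a' b' k₁ k₂ k₃ * (f k₁ + f k₂ - f k₃ - f (k₁ + k₂ - k₃)) ^ 2 ≤
      c * (collisionWeight ω₂ a b k₁ k₂ k₃ * (f k₁ + f k₂ - f k₃ - f (k₁ + k₂ - k₃)) ^ 2) := by
    intro k₂
    unfold collisionWeight
    set Den := (dispersion ω₂ k₁ * dispersion ω₂ k₂ * dispersion ω₂ k₃ * dispersion ω₂ (k₁ + k₂ - k₃)) ^ 2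
    set J := resonanceJacobian ω₂ k₁ k₂ k₃
    set B := (f k₁ + f k₂ - f k₃ - f (k₁ + k₂ - k₃)) ^ 2
    have hnn : 0 ≤ alsPrefactor / Den / J * B := by
      have := alsPrefactor_pos
      have hJ : 0 ≤ J := abs_nonneg _
      positivity
    calc alsPrefactor * vertex a' b' k₁ k₂ k₃ ^ 2 / Den / J * B
        = vertex a' b' k₁ k₂ k₃ ^ 2 * (alsPrefactor / Den / J * B) := by ring
      _ ≤ (c * vertex a b k₁ k₂ k₃ ^ 2) * (alsPrefactor / Den / J * B) :=
          mul_le_mul_of_nonneg_right (h k₁ k₂ k₃) hnn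
      _ = c * (alsPrefactor * vertex a b k₁ k₂ k₃ ^ 2 / Den / J * B) := by ring
  by_cases heq : k₁ = k₃
  · -- degenerate fibre: the bracket vanishes identically, both sides are `0`
    subst heq
    simp
  · exact finsum_mem_mono_of_finite (hfin k₁ hk₁ k₃ hk₃ heq) fun k₂ _ => hpt k₂

/-- `|∏_j sin(k_j/2)| ≤ 1`. -/
theorem abs_sin_prod_le_one (k₁ k₂ k₃ : ℝ) :
    |Real.sin (k₁ / 2) * Real.sin (k₂ / 2) * Real.sin (k₃ / 2) * Real.sin ((k₁ + k₂ - k₃) / 2)| ≤ 1 := by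
  have h1 := Real.abs_sin_le_one (k₁ / 2)
  have h2 := Real.abs_sin_le_one (k₂ / 2)
  have h3 := Real.abs_sin_le_one (k₃ / 2)
  have h4 := Real.abs_sin_le_one ((k₁ + k₂ - k₃) / 2)
  rw [abs_mul, abs_mul, abs_mul]
  have h12 : |Real.sin (k₁ / 2)| * |Real.sin (k₂ / 2)| ≤ 1 := mul_le_one₀ h1 (abs_nonneg _) h2
  have h123 : |Real.sin (k₁ / 2)| * |Real.sin (k₂ / 2)| * |Real.sin (k₃ / 2)| ≤ 1 :=
    mul_le_one₀ h12 (abs_nonneg _) h3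
  exact mul_le_one₀ h123 (abs_nonneg _) h4

/-- The two-vertex family is dominated by the on-site vertex: `Φ_{a,b}² ≤ (|a| + 16|b|)² Φ_{1,0}²`
(`Φ_{1,0} = 1`). -/
theorem vertex_sq_le_onSite (a b k₁ k₂ k₃ : ℝ) :
    vertex a b k₁ k₂ k₃ ^ 2 ≤ (|a| + 16 * |b|) ^ 2 * vertex 1 0 k₁ k₂ k₃ ^ 2 := by
  have hS := abs_sin_prod_le_one k₁ k₂ k₃
  set S := Real.sin (k₁ / 2) * Real.sin (k₂ / 2) * Real.sin (k₃ / 2) * Real.sin ((k₁ + k₂ - k₃) / 2)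
  have h10 : vertex 1 0 k₁ k₂ k₃ = 1 := by simp [vertex]
  have hab : vertex a b k₁ k₂ k₃ = a + 16 * b * S := by simp [vertex, S]
  rw [h10, hab, one_pow, mul_one]
  have hbound : |a + 16 * b * S| ≤ |a| + 16 * |b| := by
    calc |a + 16 * b * S| ≤ |a| + |16 * b * S| := abs_add_le _ _
      _ = |a| + 16 * |b| * |S| := by rw [abs_mul, abs_mul]; norm_num
      _ ≤ |a| + 16 * |b| * 1 := by gcongr
      _ = |a| + 16 * |b| := by ring
  calc (a + 16 * b * S) ^ 2 = |a + 16 * b * S| ^ 2 := (sq_abs _).symm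
    _ ≤ (|a| + 16 * |b|) ^ 2 := pow_le_pow_left₀ (abs_nonneg _) hbound 2

/-- Conversely, when the on-site vertex dominates (`16|b| < |a|`), `Φ_{1,0}² ≤ (|a| - 16|b|)⁻² Φ_{a,b}²`. -/
theorem onSite_sq_le_vertex {a b : ℝ} (hab : 16 * |b| < |a|) (k₁ k₂ k₃ : ℝ) :
    vertex 1 0 k₁ k₂ k₃ ^ 2 ≤ ((|a| - 16 * |b|) ^ 2)⁻¹ * vertex a b k₁ k₂ k₃ ^ 2 := by
  have hS := abs_sin_prod_le_one k₁ k₂ k₃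
  set S := Real.sin (k₁ / 2) * Real.sin (k₂ / 2) * Real.sin (k₃ / 2) * Real.sin ((k₁ + k₂ - k₃) / 2)
  have h10 : vertex 1 0 k₁ k₂ k₃ = 1 := by simp [vertex]
  have habv : vertex a b k₁ k₂ k₃ = a + 16 * b * S := by simp [vertex, S]
  have hpos : 0 < |a| - 16 * |b| := by linarith
  rw [h10, habv, one_pow]
  have hlow : |a| - 16 * |b| ≤ |a + 16 * b * S| := by
    have h1 : |a| - |16 * b * S| ≤ |a + 16 * b * S| := by
      have := abs_sub_abs_le_abs_sub a (-(16 * b * S))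
      simpa [abs_neg, sub_neg_eq_add] using this
    have h2 : |16 * b * S| ≤ 16 * |b| := by
      rw [abs_mul, abs_mul]
      norm_num
      calc 16 * |b| * |S| ≤ 16 * |b| * 1 := by gcongr
        _ = 16 * |b| := by ring
    linarith
  have hsq : (|a| - 16 * |b|) ^ 2 ≤ (a + 16 * b * S) ^ 2 := by
    calc (|a| - 16 * |b|) ^ 2 ≤ |a + 16 * b * S| ^ 2 := pow_le_pow_left₀ hpos.le hlow 2
      _ = (a + 16 * b * S) ^ 2 := sq_abs _
  rw [← div_eq_inv_mul, le_div_iff₀ (pow_pos hpos 2), one_mul]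
  exact hsq

/-- **Any gap in the two-vertex family forces the on-site (ALS φ⁴) gap**: `HasOddSectorGap ω₂ a b
→ HasOddSectorGap ω₂ 1 0` (conditional on `ResonantSetsFinite`). Contrapositive = a VACUITY MAP
for the crux: if the pure on-site pinned band has no odd gap at some `ω₂` (an odd collisional
invariant / a closing gap of ALS's `L`), then `MourreDissolution` is vacuous at that `ω₂` for EVERY
`(lam, β)`. -/
theorem hasOddSectorGap_onSite_of {ω₂ a b : ℝ} (hfin : ResonantSetsFinite ω₂)
    (h : HasOddSectorGap ω₂ a b) : HasOddSectorGap ω₂ 1 0 := by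
  obtain ⟨g, hg, hgap⟩ := h
  set C : ℝ := (|a| + 16 * |b|) ^ 2 + 1 with hC
  have hCpos : 0 < C := by positivity
  refine ⟨g / C, div_pos hg hCpos, fun f hp hm ho hn => ?_⟩
  have hdom : boltzmannForm ω₂ a b f ≤ ENNReal.ofReal C * boltzmannForm ω₂ 1 0 f :=
    boltzmannForm_le_of_vertex_sq_le hfin hCpos.le (fun k₁ k₂ k₃ =>
      (vertex_sq_le_onSite a b k₁ k₂ k₃).trans (by
        have := sq_nonneg (vertex 1 0 k₁ k₂ k₃)
        nlinarith)) f
  have h1 : ENNReal.ofReal C * (ENNReal.ofReal (g / C) * cellNormSq f) ≤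
      ENNReal.ofReal C * boltzmannForm ω₂ 1 0 f := by
    calc ENNReal.ofReal C * (ENNReal.ofReal (g / C) * cellNormSq f)
        = ENNReal.ofReal g * cellNormSq f := by
          rw [← mul_assoc, ← ENNReal.ofReal_mul hCpos.le, mul_div_cancel₀ g hCpos.ne']
      _ ≤ boltzmannForm ω₂ a b f := hgap f hp hm ho hn
      _ ≤ ENNReal.ofReal C * boltzmannForm ω₂ 1 0 f := hdom
  exact (ENNReal.mul_le_mul_iff_right (ENNReal.ofReal_pos.2 hCpos).ne' ENNReal.ofReal_ne_top).1 h1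

/-- **On-site dominance transfers the gap**: for `16|b| < |a|` the ALS gap gives the family's
gap, `HasOddSectorGap ω₂ 1 0 → HasOddSectorGap ω₂ a b` (conditional on `ResonantSetsFinite`).
On the ray `β < lam/16` of the conjunct the crux's hypothesis is therefore EXACTLY ALS's odd gap. -/
theorem hasOddSectorGap_of_onSite {ω₂ a b : ℝ} (hfin : ResonantSetsFinite ω₂)
    (hab : 16 * |b| < |a|) (h : HasOddSectorGap ω₂ 1 0) : HasOddSectorGap ω₂ a b := by
  obtain ⟨g, hg, hgap⟩ := h
  have hpos : 0 < (|a| - 16 * |b|) ^ 2 := pow_pos (by linarith) 2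
  set c : ℝ := ((|a| - 16 * |b|) ^ 2)⁻¹ with hc
  have hcpos : 0 < c := inv_pos.2 hpos
  refine ⟨g * (|a| - 16 * |b|) ^ 2, mul_pos hg hpos, fun f hp hm ho hn => ?_⟩
  have hdom : boltzmannForm ω₂ 1 0 f ≤ ENNReal.ofReal c * boltzmannForm ω₂ a b f :=
    boltzmannForm_le_of_vertex_sq_le hfin hcpos.le (fun k₁ k₂ k₃ => onSite_sq_le_vertex hab k₁ k₂ k₃) f
  have h1 : ENNReal.ofReal g * cellNormSq f ≤ ENNReal.ofReal c * boltzmannForm ω₂ a b f :=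
    (hgap f hp hm ho hn).trans hdom
  have h2 : ENNReal.ofReal ((|a| - 16 * |b|) ^ 2) * (ENNReal.ofReal g * cellNormSq f) ≤
      ENNReal.ofReal ((|a| - 16 * |b|) ^ 2) * (ENNReal.ofReal c * boltzmannForm ω₂ a b f) := by
    gcongr
  rw [← mul_assoc, ← mul_assoc, ← ENNReal.ofReal_mul hpos.le, ← ENNReal.ofReal_mul hpos.le,
    mul_inv_cancel₀ hpos.ne', ENNReal.ofReal_one, one_mul, mul_comm ((|a| - 16 * |b|) ^ 2) g] at h2
  exact h2

/-- The vacuity map, spelled out for the crux. -/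
theorem not_hasOddSectorGap_of_not_onSite {ω₂ : ℝ} (hfin : ResonantSetsFinite ω₂)
    (h : ¬ HasOddSectorGap ω₂ 1 0) (lam β : ℝ) : ¬ HasOddSectorGap ω₂ lam β :=
  fun hg => h (hasOddSectorGap_onSite_of hfin hg)

/-- **Unconditional form (`ω₂ > 0`)**: any odd gap in the conjunct's two-vertex family forces
ALS's on-site odd gap at the same `ω₂`. -/
theorem hasOddSectorGap_onSite_of' {ω₂ a b : ℝ} (hω : 0 < ω₂) (h : HasOddSectorGap ω₂ a b) :
    HasOddSectorGap ω₂ 1 0 :=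
  hasOddSectorGap_onSite_of (resonantSetsFinite hω) h

/-- **Unconditional form (`ω₂ > 0`)**: on the on-site-dominated ray `16|b| < |a|` the family's
gap is equivalent to ALS's. -/
theorem hasOddSectorGap_iff_onSite {ω₂ a b : ℝ} (hω : 0 < ω₂) (hab : 16 * |b| < |a|) :
    HasOddSectorGap ω₂ a b ↔ HasOddSectorGap ω₂ 1 0 :=
  ⟨hasOddSectorGap_onSite_of' hω, hasOddSectorGap_of_onSite (resonantSetsFinite hω) hab⟩

/-- **Vacuity map for the crux, unconditional**: if ALS's pure on-site pinned band has no odd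
gap at some `ω₂ > 0`, the hypothesis of `MourreDissolution` fails at that `ω₂` for EVERY
`(lam, β)` — the crux says nothing there, whatever `T₀`. -/
theorem crux_hypothesis_fails_of_not_onSite {ω₂ : ℝ} (hω : 0 < ω₂) (h : ¬ HasOddSectorGap ω₂ 1 0)
    (lam β : ℝ) : ¬ HasOddSectorGap ω₂ lam β :=
  not_hasOddSectorGap_of_not_onSite (resonantSetsFinite hω) h lam β


/-! ## §4 Numerical evidence (comments only; reproducible)

Sources: (i) `GalerkinEval.lean` in the disprover's folder — a Float re-implementation of the
resolved form `q` (exact resonant fibres by monotone-arc bisection of `D_c(k) = ω(k) - ω(k+c)`,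
midpoint grid `M × M` on `(-π,π]²`, weight `(9/16π)Φ²/(ω₁ω₂ω₃ω₄)²/|ω'(k₂)-ω'(k₄)|`, Galerkin
basis `sin(nk)`, `n ≤ Nb`, Gram `π·I`), evaluated on the Lean farm (`run_cmd`); (ii) the numpy
versions, kit compute jobs j004957 (odd AND even Galerkin sectors, `Nb = 64`, 21 parameter sets
completed, `outputs/results.json`) and j005070 (level shift, `M = 1600`, `Nb = 32`, 31 tasks,
`outputs/levelshift.json`) — both cut at the 30-min wall the scheduler granted, partial outputs
delivered and consistent with (i) to all printed digits; (iii) MD job j004961 produced nothing in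
its 30 min (see (D)).

VALIDATION (normalisation = the tree's `boltzmannForm`/`inverseForm`): max resonance residual
`≤ 3·10⁻¹⁴`; exactly two critical points of `D_c` for every grid `c` (each off-diagonal fibre has
exactly ONE non-exchange zero — ALS's `h`; cf. `resonantSet_finite`, landed p68898); ALS's Jensen
bound with trial `ω⁻¹g` reproduced: `0.27400` / `0.27403` (farm / kit) at `δ = 0.02` and `0.20358`
/ `0.20316` at `δ = 0.35` (printed 0.2740, 0.2036: ALS06 (4.16)–(4.17) and the definition file);
`M = 600` vs `1200` agree to 5 digits. EVEN SECTOR (kit, generalized problem, Gram diag(2π,π,…)):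
the two lowest eigenvalues are `0` and `≤ 10⁻¹⁷` for every set — the invariants `1, ω` — and the
third is POSITIVE (e.g. 1.62e-2 at (1,1,0), 7.9e-3 at (1,1,1)): numerically `ker q = span{1, ω}`
exactly (ALS's expectation after (4.10)), no odd and no further even invariant at these `ω₂`.

(A) HYPOTHESIS SATISFIABLE wherever `a = lam ≠ 0` — the crux is NOT vacuous on the conjunct's
range. Lowest odd eigenvalues `λ₁/λ₂/λ₃` of `Q/π` (kit, Nb = 8 → 64 unless stated):
* (ω₂,a,b) = (1,1,0): 5.523e-3 / 2.854e-2 / 4.80e-2 identical at Nb = 16, 32, 48, 64 (farm,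
  M=800: 5.5053e-3 2.8466e-2 4.7959e-2 stable Nb = 12…40 while the top eigenvalue grows
  0.72 → 2.34: log confinement of oscillatory functions) ⇒ isolated `λ₁ ≈ 5.5·10⁻³ > 0`.
* (1,1,1) (the conjunct's natural point): 1.123e-2 / 2.18e-2 / 5.53e-2 stable Nb = 32…64 (farm
  Nb=40: 1.1203e-2 2.1735e-2 5.50e-2) ⇒ `g₀ ≈ 1.12·10⁻²`; (1,1,.05): 4.366e-3 stable.
* (0.5,1,0): 2.327e-2; (0.5,1,1): 5.483e-2; (0.5,1,.05): 1.831e-2; (4,1,0): 6.899e-5; (4,1,1):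
  1.206e-4; (4,1,.05): 5.603e-5; (0.857,1,0) (δ=.35): 7.921e-3; (48,1,0) (δ=.02): 5.077e-10 with
  λ₂ 2.7e-9, λ₃ 6.4e-9 (the near-invariants `f(k)+f(π-k)=0` of the δ→0 kernel, ALS06 after
  (4.10)) — all stable in Nb. In the natural unit `(ω₂+2)⁻⁴` the on-site gap is 0.9 (ω₂=.5), 0.45
  (1), 0.09 (4), 0.003 (48): it closes roughly like `δ²` as `δ → 0`, not at any finite `ω₂` here.
(B) HYPOTHESIS FAILS on the FPU axis `a = 0` (outside the conjunct, inside the family): λ₁ never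
stabilises — (1,0,1): 3.177e-3 (8) 3.085e-3 (16) 3.077e-3 (32) 2.246e-3 (48) 1.284e-3 (64), with
λ₂ marching down 3.0e-2 → 1.19e-2 → 4.8e-3 → 3.1e-3 → 3.08e-3 (`∝ Nb^{-1.7}`, a continuum
descending to 0); (0.5,0,1): 1.71e-2 (8–16) 1.58e-2 (32) 7.6e-3 (48) 4.3e-3 (64); (4,0,1): λ₂
2.0e-4 → 5.8e-5 still falling at 64. With a small on-site part the descent is slowed, not stopped
at Nb = 64: (1,.05,1): 2.94e-3 → 1.97e-3; (0.5,.05,1): 1.57e-2 → 7.8e-3 (floor expected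
`≍ a² log(b/a)`, below resolution). Mechanism (§3b): the vertex `16b∏sin(k_j/2)` switches off
every collision of a `k → 0` phonon; odd bumps at `|k| ≲ ε` have Rayleigh quotient
`≲ ε² log(1/ε)`. So numerically `HasOddSectorGap ω₂ a b ⟺ a ≠ 0`: sufficient for the route, not
necessary for a finite kinetic conductivity (`φᵀQ⁻¹φ = 18.9` stays finite at (1,0,1)).
(C) THE CRITICAL VALUE 0 OF THE FREE RESONANCE (the planner's why-might-fail), tested on the
SECOND-ORDER LEVEL-SHIFT FORM `Γ_ν` (= `q` with `δ(Ω)` → `δ(Ω-ν)`, displaced exchange zero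
included). `ν ↦ Γ_ν` is even in `ν` (± checked). On smooth odd vectors it is CONTINUOUS at 0
with a super-linear modulus — (1,1,0), kit M=1600 Nb=32:
  ν:          0       .002     .005     .01      .02      .05      .1       .2
  Γ_ν(Pφ)×10²: 4.1340  4.1361   4.1439   4.1652   4.2278   4.4809   4.9578   5.5680
  λ₁(Γ_ν)×10³: 5.52    5.65     6.09     7.21     10.41    21.69    33.30    38.66
  φᵀΓ_ν⁻¹φ:   7.0407  7.0401   7.0381   7.0342   7.0314   7.0563   7.1529   7.5231
  `Γ_ν(Pφ) - Γ_0(Pφ) ≈ 0.6 |ν|^{1.65}`; the conductivity-like inverse functional is flat to 0.1 %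
  for |ν| ≤ .02 (for (1,1,1) it is softer: 9.58 → 9.41 (.002) → 8.89 (.005) → 8.01 (.01),
  `≈ -c|ν|^{1.3}`, still → its ν = 0 value).
BUT the convergence is NOT UNIFORM in the mode index: relative change of the diagonal
`Q_nn(ν)/Q_nn(0) - 1` at ν = .002 ((1,1,0)): ≤ 1 % for n ≤ 4, +7 % (n=5), +27 % (8), +69 % (13),
+74 % (16), +89 % (21), +96 % (29); `‖Γ_ν - Γ_0‖_F/‖Γ_0‖_F = 0.74` (ν=.002), `≈ 1` for ν ≥ .005.
A mode of wavelength `1/n` decouples from `ν` only below `ν_c(n) ≈ 0.4 n⁻²` — exactly the saddle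
normal form `Ω = Axs + (B/2)s²` at the equal-group-velocity crossings, whose crossover layer has
width `√ν` in `k₃`: functions varying on that scale are not "smooth". CONSEQUENCES for the line:
(i) no kill — the second-order density is continuous at 0 on the current vector and on the soft
odd modes, the Drude atom dissolves into a flat plateau at this order; (ii) the level-shift
operator is norm-DIScontinuous at ν = 0 on `L²` (relative form bound of `Γ_ν - Γ_0` w.r.t. `Γ_0`
does not → 0), strongly continuous with modulus `≈ |ν|^{3/2}` on `C²` vectors: any Mourre/LAP
proof must carry weights that see the `√ν`-layer (a conjugate operator adapted to the saddle,
'weakly conjugate' in the planner's words) — the log-divergent bare density of states is killed by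
the bracket only vector-wise.
(D) CONCLUSION-SIDE MD (kill signatures: atom / cusp at ω = 0 in the current periodogram of
`pinnedChain 1 1 1`, T = 0.1–1): job j004961 got a 30-min wall and finished no run (each N=1024
run needs ≈ 30 min/core); not re-submitted at this priority. Literature stand-in: ALS06 §5 Fig. 5,
MD `T²κ` of the on-site chain vs kinetic `0.28 δ^{-3/2}`: "surprisingly good agreement, which
improves as the temperature is lowered" (T = 0.1, 0.4; δ up to 0.3) — finite positive κ at
accessible T, i.e. no atom and no divergent density where kinetic theory already applies.
-/

/-! ## §5 The only uniform kill of the conclusion: a Drude weight (kill criterion (a), formal) -/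

section DrudeBridge

open Filter Topology

/-- Fubini for the cosine transform of a finite measure over a bounded time interval. -/
theorem intervalIntegral_cosTransform (σ : Measure ℝ) [IsFiniteMeasure σ] {τ : ℝ} (hτ : 0 ≤ τ) :
    ∫ t in (0:ℝ)..τ, ∫ ω, Real.cos (ω * t) ∂σ = ∫ ω, (∫ t in (0:ℝ)..τ, Real.cos (ω * t)) ∂σ := by
  simp only [intervalIntegral.integral_of_le hτ]
  haveI : IsFiniteMeasure (volume.restrict (Ioc (0:ℝ) τ)) :=
    isFiniteMeasure_restrict.2 measure_Ioc_lt_top.ne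
  have hint : Integrable (Function.uncurry fun (t ω : ℝ) => Real.cos (ω * t))
      ((volume.restrict (Ioc (0:ℝ) τ)).prod σ) := by
    refine (integrable_const (1:ℝ)).mono' ?_ (Eventually.of_forall fun p => ?_)
    · exact (Real.continuous_cos.comp (continuous_snd.mul continuous_fst)).aestronglyMeasurable
    · obtain ⟨t, ω⟩ := p
      rw [Function.uncurry_apply_pair, Real.norm_eq_abs]
      exact Real.abs_cos_le_one _
  exact integral_integral_swap hint

/-- `τ⁻¹ ∫₀^τ cos(ωt) dt = sin(ωτ)/(ωτ)` for `ω ≠ 0`. -/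
theorem inv_mul_intervalIntegral_cos {ω : ℝ} (hω : ω ≠ 0) (τ : ℝ) :
    τ⁻¹ * ∫ t in (0:ℝ)..τ, Real.cos (ω * t) = Real.sin (ω * τ) / (ω * τ) := by
  rw [intervalIntegral.integral_comp_mul_left (fun x => Real.cos x) hω, integral_cos]
  simp only [mul_zero, Real.sin_zero, sub_zero, smul_eq_mul]
  ring

/-- The averaged kernel is bounded by `1`. -/
theorem abs_sin_div_self_le (x : ℝ) : |Real.sin x / x| ≤ 1 := by
  rcases eq_or_ne x 0 with rfl | hx
  · simp
  · rw [abs_div, div_le_one (abs_pos.2 hx)]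
    exact Real.abs_sin_le_abs

/-- The averaged kernel tends to `0` for `ω ≠ 0`. -/
theorem tendsto_sin_div (ω : ℝ) (hω : ω ≠ 0) :
    Tendsto (fun τ : ℝ => Real.sin (ω * τ) / (ω * τ)) atTop (𝓝 0) := by
  have h1 : Tendsto (fun τ : ℝ => (|ω| * τ)⁻¹) atTop (𝓝 0) := by
    apply tendsto_inv_atTop_zero.comp
    exact Tendsto.const_mul_atTop (abs_pos.2 hω) tendsto_id
  refine squeeze_zero_norm' ?_ h1
  filter_upwards [eventually_gt_atTop 0] with τ hτ
  rw [Real.norm_eq_abs, abs_div, abs_mul, abs_of_pos hτ]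
  exact div_le_div_of_nonneg_right (Real.abs_sin_le_one _) (by positivity) |>.trans_eq (by rw [one_div])

/-- **No Drude weight under a window density.** If the finite measure `σ` is absolutely
continuous on some window `(-δ, δ)` (ANY density; continuity and `g(0) > 0` are not used), the
Cesàro mean of its cosine transform vanishes: `τ⁻¹ ∫₀^τ (∫ cos(ωt) dσ) dt → σ({0}) = 0`
(Fubini; `τ⁻¹∫₀^τ cos(ωt)dt = sin(ωτ)/(ωτ) → 𝟙_{ω=0}` boundedly; dominated convergence). -/
theorem tendsto_cesaro_cosTransform_zero (σ : Measure ℝ) [IsFiniteMeasure σ] {δ : ℝ} (hδ : 0 < δ)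
    {g : ℝ → ℝ}
    (hwin : σ.restrict (Ioo (-δ) δ) =
      (volume.restrict (Ioo (-δ) δ)).withDensity (fun ω => ENNReal.ofReal (g ω))) :
    Tendsto (fun τ : ℝ => τ⁻¹ * ∫ t in (0:ℝ)..τ, ∫ ω, Real.cos (ω * t) ∂σ) atTop (𝓝 0) := by
  -- σ charges no point of the window, in particular not `0`
  have h0 : σ {0} = 0 := by
    have hmem : (0:ℝ) ∈ Ioo (-δ) δ := ⟨by linarith, hδ⟩
    have : σ {0} = σ.restrict (Ioo (-δ) δ) {0} := by
      rw [Measure.restrict_apply (measurableSet_singleton 0), inter_eq_left.2 (singleton_subset_iff.2 hmem)]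
    rw [this, hwin, withDensity_apply _ (measurableSet_singleton 0)]
    have hres : (volume.restrict (Ioo (-δ) δ)).restrict {(0:ℝ)} = 0 := by
      rw [Measure.restrict_eq_zero, Measure.restrict_apply (measurableSet_singleton 0)]
      exact measure_mono_null inter_subset_left (Real.volume_singleton)
    rw [hres, lintegral_zero_measure]
  have hae : ∀ᵐ ω ∂σ, ω ≠ 0 := by
    rw [ae_iff]
    simpa using h0
  -- the Cesàro mean is `∫ sin(ωτ)/(ωτ) dσ(ω)` for `τ > 0`
  have hK : ∀ τ : ℝ, 0 < τ → τ⁻¹ * ∫ t in (0:ℝ)..τ, ∫ ω, Real.cos (ω * t) ∂σ =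
      ∫ ω, Real.sin (ω * τ) / (ω * τ) ∂σ := by
    intro τ hτ
    rw [intervalIntegral_cosTransform σ hτ.le, ← integral_const_mul]
    refine integral_congr_ae ?_
    filter_upwards [hae] with ω hω
    exact inv_mul_intervalIntegral_cos hω τ
  have hlim : Tendsto (fun τ : ℝ => ∫ ω, Real.sin (ω * τ) / (ω * τ) ∂σ) atTop (𝓝 (∫ _ω, (0:ℝ) ∂σ)) := by
    refine tendsto_integral_filter_of_dominated_convergence (fun _ => (1:ℝ)) ?_ ?_ (integrable_const 1) ?_
    · refine Eventually.of_forall fun τ => ?_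
      exact (Measurable.div (Real.measurable_sin.comp (measurable_id.mul_const τ))
        (measurable_id.mul_const τ)).aestronglyMeasurable
    · refine Eventually.of_forall fun τ => Eventually.of_forall fun ω => ?_
      rw [Real.norm_eq_abs]
      exact abs_sin_div_self_le _
    · filter_upwards [hae] with ω hω
      exact tendsto_sin_div ω hω
  rw [integral_zero] at hlim
  refine hlim.congr' ?_
  filter_upwards [eventually_gt_atTop 0] with τ hτ
  exact (hK τ hτ).symm

/-- **Every witness of the conclusion has zero Drude weight**: if `C = D.currentCorrelation μ` is
the cosine transform of a finite `σ` with a window density, then `τ⁻¹ ∫₀^τ C(t) dt → 0`. With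
`ZeroWavenumberData`, `C(t) = ⟪[J], U_t [J]⟫₀` (`inner_currentClass_koopman_eq_currentCorrelation`)
and, for a strongly continuous Koopman group, the limit is `‖P_{𝒬₀}[J]‖² = currentDrudeWeight`
(`Mazur.tendsto_inv_mul_integral_inner`): the route's milestone `NoOddDrudeWeight` is thus a
NECESSARY condition of `DissolvedAt`, not only a step towards it. -/
theorem cesaro_currentCorrelation_zero_of_window {P : OscillatorChain} (D : InfiniteChainDynamics P)
    (μ : Measure ChainConfig) (σ : Measure ℝ) [IsFiniteMeasure σ]
    (hC : ∀ t : ℝ, D.currentCorrelation μ t = ∫ ω, Real.cos (ω * t) ∂σ) {δ : ℝ} (hδ : 0 < δ)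
    {g : ℝ → ℝ}
    (hwin : σ.restrict (Ioo (-δ) δ) =
      (volume.restrict (Ioo (-δ) δ)).withDensity (fun ω => ENNReal.ofReal (g ω))) :
    Tendsto (fun τ : ℝ => τ⁻¹ * ∫ t in (0:ℝ)..τ, D.currentCorrelation μ t) atTop (𝓝 0) := by
  have h := tendsto_cesaro_cosTransform_zero σ hδ hwin
  refine h.congr fun τ => ?_
  congr 1
  exact intervalIntegral.integral_congr fun t _ => (hC t).symm

/-- **Kill criterion (a), formal.** If at `(ω₂, lam, β, γ; T)` EVERY admissible pair — DLR state
`μ_T`, `μ_T`-preserving dynamics with absolutely convergent correlations — has a current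
autocorrelation whose Cesàro mean does not tend to `0` (a Drude weight; by Mazur's inequality an odd
conserved charge `Q` of the equations of motion with `⟨J Q⟩_{μ_T} ≠ 0` for every Gibbs `μ_T` does
it for every `D` at once, because orbits of every `D` are solutions), then the conclusion of the
crux fails there. -/
theorem not_dissolvedAt_of_drudeWeight {ω₂ lam β γ T : ℝ}
    (h : ∀ (μT : Measure ChainConfig) (D : InfiniteChainDynamics (pinnedChain ω₂ lam β γ)),
      (pinnedChain ω₂ lam β γ).IsChainGibbsMeasure T μT → D.PreservesMeasure μT →
      (∀ t : ℝ, D.HasAbsConvergentCorrelation μT t) →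
      ¬ Tendsto (fun τ : ℝ => τ⁻¹ * ∫ t in (0:ℝ)..τ, D.currentCorrelation μT t) atTop (𝓝 0)) :
    ¬ DissolvedAt ω₂ lam β γ T := by
  rintro ⟨μT, D, hG, hP, hA, σ, hσ, hC, δ, g, hδ, -, -, -, hwin⟩
  exact h μT D hG hP hA (cesaro_currentCorrelation_zero_of_window D μT σ hC hδ hwin)

/-- **Refutation schema for the crux (kill criterion (c): a Drude weight WITH a kinetic gap).**
A parameter point with a PROVED odd-sector gap at which, for temperatures accumulating at `0`,
every admissible `(μ_T, D)` carries a Drude weight, refutes `MourreDissolution`. Both inputs are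
open: no gap point is proved (FGRGap) and no odd conserved charge of the anharmonic pinned chain is
known — this is the precise sense in which the crux resists. -/
theorem not_mourreDissolution_of_drudeWeight {ω₂ lam β γ : ℝ} (hω : 0 < ω₂) (hl : 0 < lam)
    (hβ : 0 < β) (hγ : 0 < γ) (hgap : HasOddSectorGap ω₂ lam β)
    (h : ∀ T₀ : ℝ, 0 < T₀ → ∃ T : ℝ, 0 < T ∧ T < T₀ ∧
      ∀ (μT : Measure ChainConfig) (D : InfiniteChainDynamics (pinnedChain ω₂ lam β γ)),
        (pinnedChain ω₂ lam β γ).IsChainGibbsMeasure T μT → D.PreservesMeasure μT →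
        (∀ t : ℝ, D.HasAbsConvergentCorrelation μT t) →
        ¬ Tendsto (fun τ : ℝ => τ⁻¹ * ∫ t in (0:ℝ)..τ, D.currentCorrelation μT t) atTop (𝓝 0)) :
    ¬ MourreDissolution := by
  intro hMD
  obtain ⟨T₀, hT₀, hT⟩ := (mourreDissolution_iff.1 hMD) ω₂ lam β γ hω hl hβ hγ hgap
  obtain ⟨T, h1, h2, hdrude⟩ := h T₀ hT₀
  exact not_dissolvedAt_of_drudeWeight hdrude (hT T h1 h2)

end DrudeBridge

/-! ## §6 Near-miss: the harmonic Drude atom -/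

/-- **Near-miss (tightness at the harmonic corner; NOT closed).** The statement one wants:
the conclusion fails for the pinned HARMONIC chain at every temperature — the current spectral
measure of `pinnedChain ω₂ 0 0 γ` is a Drude atom of mass `> 0` at `ω = 0` plus an a.c. part
supported in `|ω| ≥ 2√ω₂`, so no window density with `g(0) > 0` exists (RLL 1967 / Mazur 1969;
`Literature.Barriers.AtomisticToContinuum.HarmonicChainBallisticFlux` is the finite-chain shadow).
By §5 (`not_dissolvedAt_of_drudeWeight`) it suffices to show that EVERY admissible `(μ, D)` of the
harmonic chain has a current Drude weight. OBSTRUCTION: the conserved normal-mode actions of the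
harmonic chain are conserved along the PHYSICAL tempered solutions; to know they are conserved
along the orbits of an arbitrary `μ`-preserving `InfiniteChainDynamics` one needs uniqueness of
solutions of the infinite linear lattice ODE inside an arbitrary `μ`-full carrier (Tychonoff-type
null solutions exist for lattice equations without growth conditions; the structure's `unique`
field is relative to the carrier, pointwise in time), plus the classification of the DLR states
(Gaussian, with a two-parameter family of non-translation-invariant means `A e^{θx} + B e^{-θx}`)
to evaluate `⟨J Q⟩_μ ≠ 0`. None of this is in the tree (LLL Thm 2/4 statements only). Tried:
the kinetic shadow `not_hasOddSectorGap_zero_zero` (§2) and the bridge of §5. -/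
theorem harmonic_drude_atom (ω₂ γ T : ℝ) (hω : 0 < ω₂) (hT : 0 < T) :
    ¬ DissolvedAt ω₂ 0 0 γ T := by
  sorry

end Summit.AtomisticToContinuum.FouriersLaw.Cruxes.MourreDissolution.Disproof

end
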